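import Summits.ResolutionOfSingularities.ResolutionOfSingularities.Theorems.HomologicalConductorNoZenoParasite
import HarnessLib

/-!
# Crux `NoZenoR` / `NoZeno` (stmt-ResolutionOfSingularities-19943 / -16483), β-front structure:
# PARASITE VALUATION RINGS AND SINGULAR THREADS (II) — prime threads localise

Route `ResolutionOfSingularities/HomologicalConductor`.  OURS (cell res-hironaka: ideator
res-L0-w44-idea-1, round 6, `Sketch-idea-1-r6.lean` sha16 `6ae3bce5c33cc7eb` §g6.4–§g6.5; ported by
res-L0-w44-stub-2 per CHAIN W4.4 v10 §2 / note 40).  Nothing here is a statement of the manuscript under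
review; AI analysis, weaker than expert review.

Part I (`…Theorems.HomologicalConductorNoZenoParasite`) defined `SingularThread` (local subrings
`D_m ⊇ T_m` dominated along the tower, centres non-units, an escaping unit) and `SingularPrimeThread`
(a compatible chain of primes `𝔭_m ⊇ ca (T_m)` off which some positive-value stage element lives), and
stated S1 `PrimeThreadLocalises : SingularPrimeThread O A → SingularThread O A`.  Here:

* for `locPrime T P hP` (part I: the local ring `T_P` of a stage `T` at a prime `P`, realised INSIDE
  `K` as the subring of fractions `a * b⁻¹`, `a, b ∈ T`, `b ∉ P`): membership / inversion lemmas,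
  `NumInP` («numerator in `P`», part I) = its non-units, `isLocalRing_locPrime`.
* S1 `singularThread_of_singularPrimeThread` / `primeThreadLocalises_holds : PrimeThreadLocalises` with
  `D_m := locPrime (T_m) (𝔭_m)`: `D_m ⊆ D_(m+1)` by compatibility, units reflect, nonzero centre
  elements are non-units, the escaping `s ∉ 𝔭_m` is a unit.
* T4′ `not_exhausts_of_singularPrimeThread` and C1′ `stubExh_noSingularPrimeThread` (over the literal
  binders of `stub_kernelRankOneHighExh`): the exhaustive rank-one regime carries no singular prime
  thread.

Design note: `Localization.AtPrime` would give an abstract local ring; the thread calculus of part I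
needs the `D_m` as subrings of the one field `K` (domination is tested on elements of `K`), whence the
explicit fraction subring.  Pure-proof file: no definitions, no named facts, no new axioms, no sorry.
-/

noncomputable section

-- single-problem summit: the doubled namespace component `ResolutionOfSingularities` is forced
set_option linter.dupNamespace false

namespace Summit.ResolutionOfSingularities.ResolutionOfSingularities.Theorems.NoZeno.SandwichCluster.Parasite

open Summit.ResolutionOfSingularities.ResolutionOfSingularities.Theorems.NoZeno.Birth
open Summit.ResolutionOfSingularities.ResolutionOfSingularities.Theorems
open Literature.AlgebraicGeometry.Resolution IsLocalRing Polynomial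

variable {k K : Type} [Field k] [Field K] [Algebra k K]

/-! ## The explicit localisation `locPrime` (defined in part I): inversion lemmas, locality -/

/-- Stage elements are in the localisation (`s = s * 1⁻¹`). [this work] -/
theorem mem_locPrime_of_mem (T : Subalgebra k K) (P : Ideal ↥T) (hP : P.IsPrime) {s : K}
    (hs : s ∈ T) : s ∈ locPrime T P hP :=
  ⟨s, 1, hs, T.one_mem, fun h => hP.ne_top (P.eq_top_of_isUnit_mem h isUnit_one), by simp⟩

/-- Elements of `T` outside `P` are inverted. [this work] -/
theorem inv_mem_locPrime_of_not_mem (T : Subalgebra k K) (P : Ideal ↥T) (hP : P.IsPrime) {s : K}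
    (hs : s ∈ T) (hsP : (⟨s, hs⟩ : ↥T) ∉ P) : s⁻¹ ∈ locPrime T P hP :=
  ⟨1, s, T.one_mem, hs, hsP, by simp⟩

/-- Nonzero elements of `P` are NOT inverted. [this work] -/
theorem inv_not_mem_locPrime_of_mem (T : Subalgebra k K) (P : Ideal ↥T) (hP : P.IsPrime) {x : K}
    (hx : x ∈ T) (hxP : (⟨x, hx⟩ : ↥T) ∈ P) (hx0 : x ≠ 0) : x⁻¹ ∉ locPrime T P hP := by
  rintro ⟨a, b, ha, hb, hbP, h⟩
  have hb0 : b ≠ 0 := ne_zero_of_not_mem_ideal T P hb hbP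
  have h2 : b = a * x := by
    have h1 : x⁻¹ * (x * b) = a * b⁻¹ * (x * b) := by rw [h]
    have h3 : x⁻¹ * (x * b) = b := by rw [← mul_assoc, inv_mul_cancel₀ hx0, one_mul]
    have h4 : a * b⁻¹ * (x * b) = a * x := by field_simp
    rw [h3, h4] at h1
    exact h1
  apply hbP
  have : (⟨b, hb⟩ : ↥T) = ⟨a, ha⟩ * ⟨x, hx⟩ := Subtype.ext h2
  rw [this]
  exact P.mul_mem_left _ hxP

/-- `NumInP T P` is closed under addition (common denominator; `P` prime). [this work] -/
theorem numInP_add (T : Subalgebra k K) (P : Ideal ↥T) (hP : P.IsPrime) {y z : K}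
    (hy : NumInP T P y) (hz : NumInP T P z) : NumInP T P (y + z) := by
  obtain ⟨a, b, ha, hb, hbP, haP, rfl⟩ := hy
  obtain ⟨c, d, hc, hd, hdP, hcP, rfl⟩ := hz
  have hb0 : b ≠ 0 := ne_zero_of_not_mem_ideal T P hb hbP
  have hd0 : d ≠ 0 := ne_zero_of_not_mem_ideal T P hd hdP
  refine ⟨a * d + c * b, b * d, T.add_mem (T.mul_mem ha hd) (T.mul_mem hc hb), T.mul_mem hb hd,
    ?_, ?_, ?_⟩
  · intro h
    have h' : (⟨b, hb⟩ : ↥T) * ⟨d, hd⟩ ∈ P := h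
    rcases hP.mem_or_mem h' with h1 | h1
    · exact hbP h1
    · exact hdP h1
  · have : (⟨a * d + c * b, T.add_mem (T.mul_mem ha hd) (T.mul_mem hc hb)⟩ : ↥T) =
        ⟨a, ha⟩ * ⟨d, hd⟩ + ⟨c, hc⟩ * ⟨b, hb⟩ := Subtype.ext rfl
    rw [this]
    exact P.add_mem (P.mul_mem_right _ haP) (P.mul_mem_right _ hcP)
  · field_simp

/-- A fraction with numerator in `P` is not inverted in the localisation. [this work] -/
theorem inv_not_mem_locPrime_of_numInP (T : Subalgebra k K) (P : Ideal ↥T) (hP : P.IsPrime) {y : K}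
    (hy : NumInP T P y) (hy0 : y ≠ 0) : y⁻¹ ∉ locPrime T P hP := by
  obtain ⟨a, b, ha, hb, hbP, haP, rfl⟩ := hy
  rintro ⟨c, d, hc, hd, hdP, h⟩
  have hb0 : b ≠ 0 := ne_zero_of_not_mem_ideal T P hb hbP
  have hd0 : d ≠ 0 := ne_zero_of_not_mem_ideal T P hd hdP
  have ha0 : a ≠ 0 := by
    rintro rfl
    exact hy0 (by simp)
  -- from `(a * b⁻¹)⁻¹ = c * d⁻¹` get `b * d = a * c`
  have h2 : b * d = a * c := by
    have h1 : (a * b⁻¹)⁻¹ * (a * d) = c * d⁻¹ * (a * d) := by rw [h]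
    have h3 : (a * b⁻¹)⁻¹ * (a * d) = b * d := by field_simp
    have h4 : c * d⁻¹ * (a * d) = a * c := by field_simp
    rw [h3, h4] at h1
    exact h1
  have hbd : (⟨b, hb⟩ : ↥T) * ⟨d, hd⟩ ∈ P := by
    have : (⟨b, hb⟩ : ↥T) * ⟨d, hd⟩ = ⟨a, ha⟩ * ⟨c, hc⟩ := Subtype.ext h2
    rw [this]
    exact P.mul_mem_right _ haP
  rcases hP.mem_or_mem hbd with h1 | h1
  · exact hbP h1
  · exact hdP h1

/-- A fraction WITHOUT a numerator-in-`P` representation is inverted. [this work] -/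
theorem inv_mem_locPrime_of_not_numInP (T : Subalgebra k K) (P : Ideal ↥T) (hP : P.IsPrime) {y : K}
    (hy : y ∈ locPrime T P hP) (hn : ¬ NumInP T P y) : y⁻¹ ∈ locPrime T P hP := by
  obtain ⟨a, b, ha, hb, hbP, rfl⟩ := hy
  have haP : (⟨a, ha⟩ : ↥T) ∉ P := fun haP => hn ⟨a, b, ha, hb, hbP, haP, rfl⟩
  refine ⟨b, a, hb, ha, haP, ?_⟩
  rw [mul_inv, inv_inv, mul_comm]

/-- **The localisation is a local ring** (non-units = `NumInP`, closed under `+`). [this work] -/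
theorem isLocalRing_locPrime (T : Subalgebra k K) (P : Ideal ↥T) (hP : P.IsPrime) :
    IsLocalRing (locPrime T P hP) := by
  refine IsLocalRing.of_nonunits_add ?_
  intro y z hy hz
  rw [mem_nonunits_iff] at hy hz ⊢
  -- non-units have numerator in `P`
  have key : ∀ w : locPrime T P hP, ¬ IsUnit w → NumInP T P (w : K) := by
    intro w hw
    by_contra hn
    apply hw
    rw [isUnit_subring_iff_inv_mem]
    have hw0 : (w : K) ≠ 0 := by
      intro h0
      apply hn
      exact ⟨0, 1, T.zero_mem, T.one_mem,
        fun h => hP.ne_top (P.eq_top_of_isUnit_mem h isUnit_one), P.zero_mem, by simp [h0]⟩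
    exact ⟨hw0, inv_mem_locPrime_of_not_numInP T P hP w.2 hn⟩
  have hyz : NumInP T P ((y : K) + z) := numInP_add T P hP (key y hy) (key z hz)
  intro hu
  obtain ⟨h0, hinv⟩ := (isUnit_subring_iff_inv_mem _).mp hu
  exact inv_not_mem_locPrime_of_numInP T P hP hyz h0 hinv

/-! ## Prime threads localise (S1) -/

/-- **S1.** `SingularPrimeThread O A → SingularThread O A`, with `D_m := locPrime (T_m) (𝔭_m)`
(the conclusion is `SingularThread O A` unfolded). [this work] -/
theorem singularThread_of_singularPrimeThread (O : ValuationSubring K) (A : Subalgebra k K)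
    (P : ∀ m : ℕ, Ideal ↥(tower O A m)) (hP : ∀ m, (P m).IsPrime)
    (hcompat : ∀ (m : ℕ) (x : K) (hx : x ∈ tower O A m) (hx' : x ∈ tower O A (m + 1)),
        (⟨x, hx'⟩ : ↥(tower O A (m + 1))) ∈ P (m + 1) ↔ (⟨x, hx⟩ : ↥(tower O A m)) ∈ P m)
    (hca : ∀ (m : ℕ) (x : K) (hx : x ∈ tower O A m),
        x ∈ ca (tower O A m) → (⟨x, hx⟩ : ↥(tower O A m)) ∈ P m)
    (hne : ∃ m, ∃ x ∈ ca (tower O A m), x ≠ 0)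
    (hesc : ∃ (m : ℕ) (s : K) (hs : s ∈ tower O A m),
        O.valuation s < 1 ∧ (⟨s, hs⟩ : ↥(tower O A m)) ∉ P m) :
    ∃ D : ℕ → Subring K,
      (∀ m, IsLocalRing (D m)) ∧
      (∀ m, SubringDominates (D m) (D (m + 1))) ∧
      (∀ m, ∀ s ∈ tower O A m, s ∈ D m) ∧
      (∀ m, ∀ x ∈ ca (tower O A m), x ≠ 0 → x⁻¹ ∉ D m) ∧
      (∃ m, ∃ x ∈ ca (tower O A m), x ≠ 0) ∧
      (∃ m, ∃ s ∈ tower O A m, s ≠ 0 ∧ O.valuation s < 1 ∧ s⁻¹ ∈ D m) := by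
  let D : ℕ → Subring K := fun m => locPrime (tower O A m) (P m) (hP m)
  have hmono : ∀ m {x : K}, x ∈ tower O A m → x ∈ tower O A (m + 1) := fun m x hx =>
    d2rc_mem_tower_of_le O A (Nat.le_succ m) hx
  refine ⟨D, fun m => isLocalRing_locPrime _ _ _, fun m => ⟨?_, ?_⟩,
    fun m s hs => mem_locPrime_of_mem _ _ _ hs, fun m x hx hx0 => ?_, hne, ?_⟩
  · -- `D m ≤ D (m+1)`
    rintro y ⟨a, b, ha, hb, hbP, rfl⟩
    exact ⟨a, b, hmono m ha, hmono m hb, fun h => hbP ((hcompat m b hb (hmono m hb)).mp h), rfl⟩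
  · -- units of `D (m+1)` lying in `D m` are units of `D m`
    rintro y ⟨a, b, ha, hb, hbP, rfl⟩ hinv
    by_cases haP : (⟨a, ha⟩ : ↥(tower O A m)) ∈ P m
    · -- then `y` has numerator in `P (m+1)`: not inverted there unless `y = 0`
      by_cases hy0 : a * b⁻¹ = 0
      · rw [hy0, inv_zero]; exact (D m).zero_mem
      · exact absurd hinv (inv_not_mem_locPrime_of_numInP _ _ (hP (m + 1))
          ⟨a, b, hmono m ha, hmono m hb, fun h => hbP ((hcompat m b hb (hmono m hb)).mp h),
            (hcompat m a ha (hmono m ha)).mpr haP, rfl⟩ hy0)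
    · refine ⟨b, a, hb, ha, haP, ?_⟩
      rw [mul_inv, inv_inv, mul_comm]
  · -- nonzero centre elements are non-units
    exact inv_not_mem_locPrime_of_mem _ _ _ (ca_subset _ hx) (hca m x (ca_subset _ hx) hx) hx0
  · obtain ⟨m, s, hs, hvs, hsP⟩ := hesc
    exact ⟨m, s, hs, ne_zero_of_not_mem_ideal _ _ hs hsP, hvs,
      inv_mem_locPrime_of_not_mem _ _ _ hs hsP⟩

/-- **S1.** Prime threads localise (`PrimeThreadLocalises` of part I holds). [this work] -/
theorem primeThreadLocalises_holds : PrimeThreadLocalises := by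
  intro k K _ _ _ O A h
  obtain ⟨P, hP, hcompat, hca, hne, hesc⟩ := h
  exact singularThread_of_singularPrimeThread O A P hP hcompat hca hne hesc

/-- **T4′.** A rank-one tower carrying a singular PRIME thread (a compatible chain of singular
non-closed primes containing the centres, off which some positive-value stage element lives — the
algebraic shadow of a singular curve through the centres that is never resolved at its generic point)
is NOT exhaustive. [this work] -/
theorem not_exhausts_of_singularPrimeThread (O : ValuationSubring K) (A : Subalgebra k K)
    (hk : ∀ c : k, algebraMap k K c ∈ O) (hAO : A.toSubring ≤ O.toSubring) (hrk : RankOne O)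
    (h : SingularPrimeThread O A) : ¬ Exhausts O A :=
  not_exhausts_of_singularThread O A hk hAO hrk (primeThreadLocalises_holds k K O A h)

/-- **C1′ (over the literal hypotheses of `stub_kernelRankOneHighExh`).** The exhaustive rank-one
regime carries NO singular prime thread: along every compatible chain of primes `𝔭_m ⊇ ca (T_m)` off
which some positive-value element lives, some centre vanishes — the free hypothesis
«no persistent singular curve through the centres» for the Exh stub. [this work] -/
theorem stubExh_noSingularPrimeThread (O : ValuationSubring K) (A : Subalgebra k K)
    (hk : ∀ c : k, algebraMap k K c ∈ O) (hAO : A.toSubring ≤ O.toSubring)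
    (hrk : ∀ O' : ValuationSubring K, O ≤ O' → O' = O ∨ O' = ⊤)
    (hexh : ∀ x : K, x ∈ O → ∃ m : ℕ, x ∈ tower O A m) :
    ¬ SingularPrimeThread O A :=
  fun h => not_exhausts_of_singularPrimeThread O A hk hAO hrk h hexh
end Summit.ResolutionOfSingularities.ResolutionOfSingularities.Theorems.NoZeno.SandwichCluster.Parasite

end
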